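import Literature.Algebra.Homology.GroupCohomologySemilinear
import HarnessLib

/-!
# Group cohomology commutes with arbitrary products of coefficient modules:
# `Hⁿ(G, ∏ᵢ Aᵢ) ≅ ∏ᵢ Hⁿ(G, Aᵢ)` (Brown VIII §4: "`Ext_R^*(M, –)` commutes with products for any `M`")

Topic `Algebra/Homology`; namespace `Literature.Algebra.Homology.GroupCohomologyPi`.  Mathlib plus the
tree's degree-uniform glue for `groupCohomology.π` (`GroupCohomologySemilinear`: `π_surjective`,
`π_apply_eq_zero_iff`, `iCocycles_injective`, `d_iCocycles`, …).  For a `k`-linear representation `P`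
of a group `G` PRESENTED AS A PRODUCT of representations `A i` (`i : ι`, any index type) by morphisms
`π i : P ⟶ A i` whose joint map `P → Π i, A i` is bijective — this covers Mathlib's categorical product,
`Rep.ofMulDistribMulAction G (Π i, M i)`, and sub-representations of an idèle group cut out by local
conditions alike — the joint map in cohomology
`Hⁿ(G, P) → Π i, Hⁿ(G, A i)`, `c ↦ (Hⁿ(G, π i) c)ᵢ`, is bijective in every degree `n`
(`map_pi_bijective`), whence the `k`-linear isomorphism `piIso : Hⁿ(G, P) ≅ Π i, Hⁿ(G, A i)` and the
vanishing criterion `isZero_iff : Hⁿ(G, P) = 0 ↔ ∀ i, Hⁿ(G, A i) = 0`.  The proof is the cochain-level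
statement (inhomogeneous cochains of `P` ARE families of cochains of the `A i`, `cochainsPi_bijective`,
and the differential is componentwise) followed by the two diagram chases.  No finiteness on `G` or `ι`.
Written for the idèle decomposition of class field theory (Tate, Cassels–Fröhlich VII §7.3; Harari
Prop. 13.1 (b)): `Hⁿ(G, ∏_{v ∉ S} U_E(v)) ≅ ∏_{v ∉ S} Hⁿ(G, U_E(v))`, an infinite product.

## What is formalised (`k` a commutative ring, `G` a group, `P`, `A i : Rep k G`, `π i : P ⟶ A i`,
`hπ : Function.Bijective fun x i => (π i).hom x`)

* `cochainsPi P A π m`, `cochainsPi_apply`, `cochainsPi_bijective hπ m` — cochains of `P` vs families.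
* `cochainsPi_d` — the differential is componentwise.
* `mapPi P A π n : Hⁿ(G, P) →ₗ[k] Π i, Hⁿ(G, A i)`, **`map_pi_bijective hπ n`**, **`piIso hπ n`**,
  `piIso_hom_apply`, **`isZero_iff hπ n`**, `isZero_of_forall`.
* §4 the product representation of a family: `piRepr A`, `piRep A : Rep k G` (on `Π i, A i`), `piRepProj`,
  `piRepProj_bijective`, **`groupCohomologyPiRepIso A n : Hⁿ(G, Π i, A i) ≅ Π i, Hⁿ(G, A i)`**,
  `isZero_groupCohomology_piRep_iff`.
* §5 `G`-groups: `evalRepHom G M i`, `evalRepHom_bijective`, `map_pi_bijective_ofMulDistribMulAction`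
  (`Hⁿ(G, Additive (Π i, M i)) → Π i, Hⁿ(G, Additive (M i))` bijective),
  `isZero_groupCohomology_ofMulDistribMulAction_pi_iff`.

## References
* K. S. Brown, *Cohomology of Groups*, GTM 87 (1982), VIII §4 (remark after Lemma 4.7: `Ext_R^*(M, –)`
  commutes with products for any `M`), with III §1 (`H^*(G, –) = Ext_{ℤG}^*(ℤ, –)`).
  [Brown1982CohomologyGroups]
* J. W. S. Cassels, A. Fröhlich (eds.), *Algebraic Number Theory* (1967), Ch. VII (Tate) §7.3 (the
  application to `J_{L,S}`). [CasselsFrohlichANT1967]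
-/

noncomputable section

open CategoryTheory CategoryTheory.Limits groupCohomology

universe v u

namespace Literature.Algebra.Homology

namespace GroupCohomologyPi

variable {k G : Type u} [CommRing k] [Group G] {ι : Type v} (P : Rep k G) (A : ι → Rep k G)
  (π : ∀ i, P ⟶ A i)

/-! ## §1. Cochains of a product are families of cochains -/

/-- The joint cochain map `Cᵐ(G, P) → Π i, Cᵐ(G, A i)`, `x ↦ ((π i) ∘ x)ᵢ` (componentwise Mathlib's
`cochainsMap (MonoidHom.id G) (π i)` in degree `m`). [cite: Brown1982CohomologyGroups, VIII §4 (after Lemma 4.7)] -/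
def cochainsPi (m : ℕ) :
    (inhomogeneousCochains P).X m →ₗ[k] ∀ i, (inhomogeneousCochains (A i)).X m :=
  LinearMap.pi fun i => ((cochainsMap (MonoidHom.id G) (π i)).f m).hom

/-- Unfolding: the `i`-th component of `cochainsPi x` is the cochain `g ↦ (π i) (x g)`.
[cite: Brown1982CohomologyGroups, VIII §4 (after Lemma 4.7)] -/
@[simp] theorem cochainsPi_apply (m : ℕ) (x : (inhomogeneousCochains P).X m) (i : ι) (g : Fin m → G) :
    cochainsPi P A π m x i g = (π i).hom (x g) := rfl

variable {P A π} in
/-- **If `x ↦ ((π i) x)ᵢ : P → Π i, A i` is bijective, so is the joint cochain map in every degree.**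
[cite: Brown1982CohomologyGroups, VIII §4 (after Lemma 4.7)] -/
theorem cochainsPi_bijective (hπ : Function.Bijective fun (x : P) (i : ι) => (π i).hom x) (m : ℕ) :
    Function.Bijective (cochainsPi P A π m) := by
  set e := Equiv.ofBijective _ hπ with he
  refine ⟨fun x y hxy => ?_, fun t => ?_⟩
  · funext g
    apply hπ.1
    funext i
    exact (congrFun (congrFun hxy i) g : _)
  · refine ⟨fun g => e.symm (fun i => t i g), ?_⟩
    funext i g
    rw [cochainsPi_apply]
    have h : (fun j => (π j).hom (e.symm fun i => t i g)) = fun i => t i g := e.apply_symm_apply _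
    exact congrFun h i

/-- **The differential is componentwise**: `cochainsPi (d x) = (d (cochainsPi x)ᵢ)ᵢ`.
[cite: Brown1982CohomologyGroups, VIII §4 (after Lemma 4.7)] -/
theorem cochainsPi_d (m m' : ℕ) (x : (inhomogeneousCochains P).X m) (i : ι) :
    cochainsPi P A π m' ((inhomogeneousCochains P).d m m' x) i =
      (inhomogeneousCochains (A i)).d m m' (cochainsPi P A π m x i) := by
  have h := (cochainsMap (MonoidHom.id G) (π i)).comm m m'
  have h' := LinearMap.congr_fun (congrArg ModuleCat.Hom.hom h) x
  simp only [ModuleCat.hom_comp, LinearMap.comp_apply] at h'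
  exact h'.symm

/-! ## §2. The comparison in cohomology -/

/-- The joint map `Hⁿ(G, P) →ₗ[k] Π i, Hⁿ(G, A i)`, `c ↦ (Hⁿ(G, π i) c)ᵢ`.
[cite: Brown1982CohomologyGroups, VIII §4 (after Lemma 4.7)] -/
def mapPi (n : ℕ) : groupCohomology P n →ₗ[k] ∀ i, groupCohomology (A i) n :=
  LinearMap.pi fun i => (groupCohomology.map (MonoidHom.id G) (π i) n).hom

/-- Unfolding of `mapPi`. [cite: Brown1982CohomologyGroups, VIII §4 (after Lemma 4.7)] -/
@[simp] theorem mapPi_apply (n : ℕ) (c : groupCohomology P n) (i : ι) :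
    mapPi P A π n c i = groupCohomology.map (MonoidHom.id G) (π i) n c := rfl

/-- The component cocycle map has underlying cochain `(π i) ∘ z`.
[cite: Brown1982CohomologyGroups, VIII §4 (after Lemma 4.7)] -/
theorem iCocycles_cocyclesMap (n : ℕ) (z : cocycles P n) (i : ι) :
    iCocycles (A i) n (cocyclesMap (MonoidHom.id G) (π i) n z) = cochainsPi P A π n (iCocycles P n z) i := by
  have h := LinearMap.congr_fun (congrArg ModuleCat.Hom.hom
    (HomologicalComplex.cyclesMap_i (cochainsMap (MonoidHom.id G) (π i)) n)) z
  simp only [ModuleCat.hom_comp, LinearMap.comp_apply] at h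
  exact h

variable {P A π} in
/-- **`Hⁿ(G, –)` commutes with products: `c ↦ (Hⁿ(G, π i) c)ᵢ : Hⁿ(G, P) → Π i, Hⁿ(G, A i)` is
bijective** whenever `P → Π i, A i` is. [cite: Brown1982CohomologyGroups, VIII §4 (after Lemma 4.7)] -/
theorem map_pi_bijective (hπ : Function.Bijective fun (x : P) (i : ι) => (π i).hom x) (n : ℕ) :
    Function.Bijective (mapPi P A π n) := by
  constructor
  · -- injectivity: a class whose components are coboundaries is a coboundary
    rw [injective_iff_map_eq_zero]
    intro c hc
    obtain ⟨z, rfl⟩ := π_surjective P n c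
    have hcomp : ∀ i, ∃ w : (inhomogeneousCochains (A i)).X (n - 1),
        (inhomogeneousCochains (A i)).d (n - 1) n w = cochainsPi P A π n (iCocycles P n z) i := by
      intro i
      have hi : groupCohomology.π (A i) n (cocyclesMap (MonoidHom.id G) (π i) n z) = 0 := by
        have := congrFun hc i
        rw [mapPi_apply, Pi.zero_apply] at this
        rwa [groupCohomology.π_map_apply] at this
      obtain ⟨w, hw⟩ := (π_apply_eq_zero_iff (A i) n _).1 hi
      refine ⟨w, ?_⟩
      rw [← iCocycles_toCocycles, hw, iCocycles_cocyclesMap]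
    choose w hw using hcomp
    obtain ⟨y, hy⟩ := (cochainsPi_bijective hπ (n - 1)).2 w
    have hdy : (inhomogeneousCochains P).d (n - 1) n y = iCocycles P n z := by
      apply (cochainsPi_bijective hπ n).1
      funext i
      rw [cochainsPi_d, hy, hw]
    have hz : toCocycles P (n - 1) n y = z := by
      apply iCocycles_injective P n
      rw [iCocycles_toCocycles, hdy]
    rw [← hz]
    exact π_toCocycles P (n - 1) n y
  · -- surjectivity: a family of cocycles is a cocycle of the product
    intro c
    have hrep : ∀ i, ∃ z : cocycles (A i) n, groupCohomology.π (A i) n z = c i :=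
      fun i => π_surjective (A i) n (c i)
    choose z hz using hrep
    obtain ⟨x, hx⟩ := (cochainsPi_bijective hπ n).2 fun i => iCocycles (A i) n (z i)
    have hdx : inhomogeneousCochains.d P n x = 0 := by
      have h1 : (inhomogeneousCochains P).d n (n + 1) x = 0 := by
        apply (cochainsPi_bijective hπ (n + 1)).1
        funext i
        rw [cochainsPi_d, hx, map_zero, Pi.zero_apply]
        have := d_iCocycles (A i) n (z i)
        rwa [← inhomogeneousCochains.d_def] at this
      rwa [inhomogeneousCochains.d_def] at h1
    refine ⟨groupCohomology.π P n (cocyclesMk x hdx), funext fun i => ?_⟩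
    rw [mapPi_apply, groupCohomology.π_map_apply, ← hz i]
    congr 1
    apply iCocycles_injective (A i) n
    rw [iCocycles_cocyclesMap, iCocycles_mk]
    exact congrFun hx i

/-! ## §3. Packaging: the isomorphism and the vanishing criterion -/

variable {P A π} in
/-- **`Hⁿ(G, P) ≅ Π i, Hⁿ(G, A i)`** as `k`-modules (for an index type in the universe of `k`, `G`).
[cite: Brown1982CohomologyGroups, VIII §4 (after Lemma 4.7)] -/
def piIso {ι : Type u} {A : ι → Rep k G} {π : ∀ i, P ⟶ A i}
    (hπ : Function.Bijective fun (x : P) (i : ι) => (π i).hom x) (n : ℕ) :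
    groupCohomology P n ≅ ModuleCat.of k (∀ i, groupCohomology (A i) n) :=
  (LinearEquiv.ofBijective (mapPi P A π n) (map_pi_bijective hπ n)).toModuleIso

/-- Unfolding: `piIso` is `mapPi` = `(Hⁿ(G, π i))ᵢ`. [cite: Brown1982CohomologyGroups, VIII §4 (after Lemma 4.7)] -/
@[simp] theorem piIso_hom_apply {ι : Type u} {A : ι → Rep k G} {π : ∀ i, P ⟶ A i}
    (hπ : Function.Bijective fun (x : P) (i : ι) => (π i).hom x) (n : ℕ) (c : groupCohomology P n)
    (i : ι) : (piIso hπ n).hom c i = groupCohomology.map (MonoidHom.id G) (π i) n c := rfl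

variable {P A π} in
/-- **`Hⁿ(G, P) = 0 ↔ Hⁿ(G, A i) = 0` for every `i`** (any index type).
[cite: Brown1982CohomologyGroups, VIII §4 (after Lemma 4.7)] -/
theorem isZero_iff (hπ : Function.Bijective fun (x : P) (i : ι) => (π i).hom x) (n : ℕ) :
    IsZero (groupCohomology P n) ↔ ∀ i, IsZero (groupCohomology (A i) n) := by
  classical
  simp only [ModuleCat.isZero_iff_subsingleton]
  constructor
  · intro h i
    refine ⟨fun a b => ?_⟩
    obtain ⟨a', ha⟩ := (map_pi_bijective hπ n).2 (Pi.single i a)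
    obtain ⟨b', hb⟩ := (map_pi_bijective hπ n).2 (Pi.single i b)
    have : a' = b' := Subsingleton.elim _ _
    have h2 := congrFun ha i
    have h3 := congrFun hb i
    rw [Pi.single_eq_same] at h2 h3
    rw [← h2, ← h3, this]
  · intro h
    refine ⟨fun a b => (map_pi_bijective hπ n).1 (funext fun i => Subsingleton.elim _ _)⟩

variable {P A π} in
/-- `Hⁿ(G, A i) = 0` for all `i` ⇒ `Hⁿ(G, P) = 0`. [cite: Brown1982CohomologyGroups, VIII §4 (after Lemma 4.7)] -/
theorem isZero_of_forall (hπ : Function.Bijective fun (x : P) (i : ι) => (π i).hom x) (n : ℕ)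
    (h : ∀ i, IsZero (groupCohomology (A i) n)) : IsZero (groupCohomology P n) :=
  (isZero_iff hπ n).2 h

/-! ## §4. The product representation of a family (`Π i, A i` with the componentwise action) -/

section PiRep

variable {ι : Type u} (A : ι → Rep k G)

/-- The componentwise representation of `G` on `Π i, A i` (any commutative coefficient ring; the tree's
`Representation.pi` of `RepresentationTheory/Semisimple/Multiplicity` is the same over a field).
[cite: Brown1982CohomologyGroups, VIII §4 (after Lemma 4.7)] -/
def piRepr : Representation k G (∀ i, A i) where
  toFun g := LinearMap.pi fun i => ((A i).ρ g) ∘ₗ LinearMap.proj i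
  map_one' := by ext x i; simp
  map_mul' g h := by ext x i; simp

/-- Unfolding: `(g • x) i = g • x i`. [cite: Brown1982CohomologyGroups, VIII §4 (after Lemma 4.7)] -/
@[simp] theorem piRepr_apply (g : G) (x : ∀ i, A i) (i : ι) : piRepr A g x i = (A i).ρ g (x i) := rfl

/-- **The product representation `Π i, A i`** as an object of `Rep k G`.
[cite: Brown1982CohomologyGroups, VIII §4 (after Lemma 4.7)] -/
def piRep : Rep k G := Rep.of (piRepr A)

/-- The `i`-th projection `Π i, A i ⟶ A i`, a morphism of representations.
[cite: Brown1982CohomologyGroups, VIII §4 (after Lemma 4.7)] -/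
def piRepProj (i : ι) : piRep A ⟶ A i :=
  Rep.ofHom ⟨LinearMap.proj i, fun _ => LinearMap.ext fun _ => rfl⟩

/-- Unfolding: `piRepProj A i x = x i`. [cite: Brown1982CohomologyGroups, VIII §4 (after Lemma 4.7)] -/
@[simp] theorem piRepProj_hom_apply (i : ι) (x : piRep A) : (piRepProj A i).hom x = x i := rfl

/-- The projections present `piRep A` as the product (the joint map is the identity).
[cite: Brown1982CohomologyGroups, VIII §4 (after Lemma 4.7)] -/
theorem piRepProj_bijective : Function.Bijective fun (x : piRep A) (i : ι) => (piRepProj A i).hom x :=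
  ⟨fun _ _ h => funext fun i => congrFun h i, fun t => ⟨t, rfl⟩⟩

/-- **`Hⁿ(G, Π i, A i) ≅ Π i, Hⁿ(G, A i)`.** [cite: Brown1982CohomologyGroups, VIII §4 (after Lemma 4.7)] -/
def groupCohomologyPiRepIso (n : ℕ) :
    groupCohomology (piRep A) n ≅ ModuleCat.of k (∀ i, groupCohomology (A i) n) :=
  piIso (piRepProj_bijective A) n

/-- `Hⁿ(G, Π i, A i) = 0 ↔ ∀ i, Hⁿ(G, A i) = 0`. [cite: Brown1982CohomologyGroups, VIII §4 (after Lemma 4.7)] -/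
theorem isZero_groupCohomology_piRep_iff (n : ℕ) :
    IsZero (groupCohomology (piRep A) n) ↔ ∀ i, IsZero (groupCohomology (A i) n) :=
  isZero_iff (piRepProj_bijective A) n

end PiRep

end GroupCohomologyPi

/-! ## §5. Example: `G` acting on a product of commutative groups (`Rep.ofMulDistribMulAction`) -/

namespace GroupCohomologyPi

variable (G : Type) [Group G] {ι : Type} (M : ι → Type) [∀ i, CommGroup (M i)]
  [∀ i, MulDistribMulAction G (M i)]

/-- Evaluation at `i`, `Additive (Π i, M i) ⟶ Additive (M i)`, as a morphism of the representations
`Rep.ofMulDistribMulAction` (componentwise `G`-action on the product group, Mathlib's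
`Pi.mulDistribMulAction`). [cite: Brown1982CohomologyGroups, VIII §4 (after Lemma 4.7)] -/
def evalRepHom (i : ι) : Rep.ofMulDistribMulAction G (∀ i, M i) ⟶ Rep.ofMulDistribMulAction G (M i) :=
  Rep.ofHom ⟨(MonoidHom.toAdditive (Pi.evalMonoidHom M i)).toIntLinearMap,
    fun _ => LinearMap.ext fun _ => rfl⟩

/-- Unfolding: `evalRepHom G M i x = ofMul ((toMul x) i)`. [cite: Brown1982CohomologyGroups, VIII §4 (after Lemma 4.7)] -/
@[simp] theorem evalRepHom_hom_apply (i : ι) (x : Additive (∀ i, M i)) :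
    (evalRepHom G M i).hom x = Additive.ofMul ((Additive.toMul x) i) := rfl

/-- The evaluations present `Additive (Π i, M i)` as the product of the `Additive (M i)`.
[cite: Brown1982CohomologyGroups, VIII §4 (after Lemma 4.7)] -/
theorem evalRepHom_bijective :
    Function.Bijective fun (x : Rep.ofMulDistribMulAction G (∀ i, M i)) (i : ι) =>
      (evalRepHom G M i).hom x :=
  ⟨fun _ _ h => funext fun i => congrFun h i, fun t => ⟨Additive.ofMul fun i => Additive.toMul (t i), rfl⟩⟩

/-- **`Hⁿ(G, Π i, M i) → Π i, Hⁿ(G, M i)` is bijective** for a product of `G`-groups (the isomorphism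
is `piIso (evalRepHom_bijective G M) n`). [cite: Brown1982CohomologyGroups, VIII §4 (after Lemma 4.7)] -/
theorem map_pi_bijective_ofMulDistribMulAction (n : ℕ) :
    Function.Bijective (mapPi _ _ (evalRepHom G M) n) :=
  map_pi_bijective (evalRepHom_bijective G M) n

/-- `Hⁿ(G, Π i, M i) = 0 ↔ ∀ i, Hⁿ(G, M i) = 0` for a product of `G`-groups.
[cite: Brown1982CohomologyGroups, VIII §4 (after Lemma 4.7)] -/
theorem isZero_groupCohomology_ofMulDistribMulAction_pi_iff (n : ℕ) :
    IsZero (groupCohomology (Rep.ofMulDistribMulAction G (∀ i, M i)) n) ↔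
      ∀ i, IsZero (groupCohomology (Rep.ofMulDistribMulAction G (M i)) n) :=
  isZero_iff (evalRepHom_bijective G M) n

end GroupCohomologyPi

end Literature.Algebra.Homology

end
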